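import Summits.NavierStokesRegularity.FluidComputer.DesignedBlowupEnergyClass
import Summits.NavierStokesRegularity.FluidComputer.ForcedContinuationHalfOpen
import HarnessLib

/-!
# A designed forced blow-up is unbounded near its blow-up time — modulo forced local well-posedness ONLY

Cell `ns-blowup`, seat `ns-blowup-ecbridge-2` (g4; the E–C endpoint theory seat). LABEL: E–C typing
(KERNEL modulo ONE named fact, `tao2011_smooth_local_existence_forced` = Tao 2013 Thm. 5.4 (ii)+(iv)
WITH forcing, the cell's single discharge engine). WHAT THIS IS NOT: not Navier–Stokes evidence —
`DesignedBlowup ν` is a TYPE with no asserted inhabitant. Companion memo: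
`run/shared/lean/pub/ns-blowup/ecbridge2/ECBRIDGE-2-MEMO-3.md` §2 (trust base).

## Content (the `r = ∞` endpoint of row R2, sup form, with the smallest trust base the tree allows)

The seat's `DesignedBlowupSerrinDivergence.lean` proves that a designed blow-up leaves every Serrin
class, modulo the forced `H¹` alternative (LR16 Thm. 7.2) and Tao-class hypotheses on `∂ₜu` and a
pressure. ecbridge-1 g5's `ForcedContinuation.exists_forced_extension_of_bounded_Ico` (p434537:
a classical forced solution on `[0, τ)` with finite energy, BOUNDED velocity, Schwartz datum and Clay
force extends classically to a closed slab `[0, T']`, `T' > τ`, GIVEN forced smooth local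
well-posedness F2) and this seat's FACT-FREE uniform energy bound `DesignedBlowup.energy_le`
(p431638) give the `L^∞` endpoint with NO other input:

* **`DesignedBlowup.velocity_unbounded_of_F2`** — for `ν > 0`, GIVEN F2: the velocity of a designed
  blow-up is NOT bounded on `[0, T) × ℝ³`;
* `DesignedBlowup.exists_norm_gt_of_F2` — for every `M` some `(t, x) ∈ [0, T) × ℝ³` has `‖u(t,x)‖ > M`;
* `DesignedBlowup.exists_norm_gt_near_of_F2` — indeed beyond every `t₀ < T` (the design is bounded on
  each closed sub-slab `[0, t₀]`, field `bounded`), so `limsup_{t ↑ T} ‖u(t)‖_∞ = ∞`.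

READING (MEMO-1 row R2, `r = ∞`, and the BKM/Leray `L^∞` criterion WITH force): an E–C design blows up
in `L^∞` at `T*` — as a THEOREM about the type modulo F2 alone (no LR16 fact, no Tao-class
hypotheses, no pressure normalisation). The integral form `∫₀ᵀ‖u‖_∞² = ∞` and `r < ∞` stay in
`DesignedBlowupSerrinDivergence.lean` (they need the Serrin form of the restart loop, deferred by
ecbridge-1 g5).

References: T. Tao, Anal. PDE 6 (2013) = arXiv:1108.1165, Thm. 5.4 (ii)+(iv) [cite: Tao2011, Thm. 5.4];
J. Leray, Acta Math. 63 (1934), (3.16)/§20 (the `L^∞` blow-up rate) [cite: Leray1934, (3.16)];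
J. T. Beale, T. Kato, A. Majda, Comm. Math. Phys. 94 (1984), §1 [cite: BealeKatoMajda1984, §1];
C. L. Fefferman, Clay problem description, (C) [cite: FeffermanClay2006, (C)].
-/

noncomputable section

namespace Summit.NavierStokesRegularity.FluidComputer

namespace DesignedBlowup

open Set MeasureTheory Filter Topology Function
open scoped ENNReal NNReal
open Literature.Analysis.FluidPDE
open Summit.NavierStokesRegularity.FluidComputer.PalasekTowerClayBridge

variable {ν : ℝ} (D : DesignedBlowup ν)

/-- **A designed forced blow-up is NOT bounded on `[0, T) × ℝ³`, modulo forced smooth local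
well-posedness (F2) only.** If it were bounded by `M`, ecbridge-1's half-open continuation
`ForcedContinuation.exists_forced_extension_of_bounded_Ico` (with the fact-free uniform energy bound
`energy_le`, the Clay datum and force of the structure) would extend it classically to a closed slab
`[0, T']`, `T' > T` — a classical extension past `T`, which `no_extension` forbids.
[cite: Tao2011, Thm. 5.4] [cite: BealeKatoMajda1984, §1] -/
theorem velocity_unbounded_of_F2 (hF : tao2011_smooth_local_existence_forced) (hν : 0 < ν) :
    ¬ ∃ M : ℝ, ∀ t ∈ Ico 0 D.T, ∀ x, ‖D.u t x‖ ≤ M := by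
  rintro ⟨M, hM⟩
  obtain ⟨T', hT', U, P, hcl, hUu, -⟩ :=
    ForcedContinuation.exists_forced_extension_of_bounded_Ico hF hν D.T_pos D.force_smooth
      D.force_decay D.classical (D.energy_le hν) hM D.datum_decay
  refine D.no_extension ⟨T', hT', U, P, hcl.mono Ico_subset_Icc_self (uniqueDiffOn_Ico 0 T'), ?_⟩
  exact fun t ht => hUu t ht

/-- **For every bound `M` some point of `[0, T) × ℝ³` beats it** (modulo F2).
[cite: Tao2011, Thm. 5.4] [cite: Leray1934, (3.16)] -/
theorem exists_norm_gt_of_F2 (hF : tao2011_smooth_local_existence_forced) (hν : 0 < ν) (M : ℝ) :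
    ∃ t ∈ Ico 0 D.T, ∃ x, M < ‖D.u t x‖ := by
  by_contra h
  refine D.velocity_unbounded_of_F2 hF hν ⟨M, fun t ht x => ?_⟩
  exact not_lt.1 fun hlt => h ⟨t, ht, x, hlt⟩

/-- **The sup norm blows up AT `T`**: for every `t₀ < T` and every `M`, some `(t, x)` with
`t₀ < t < T` has `‖u(t,x)‖ > M` (on `[0, t₀]` the design is bounded — field `bounded` — so the large
values found by `exists_norm_gt_of_F2` lie beyond `t₀`). Modulo F2 only. [cite: Leray1934, (3.16)]
[cite: BealeKatoMajda1984, §1] -/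
theorem exists_norm_gt_near_of_F2 (hF : tao2011_smooth_local_existence_forced) (hν : 0 < ν)
    {t₀ : ℝ} (ht₀ : t₀ < D.T) (M : ℝ) :
    ∃ t ∈ Ioo t₀ D.T, ∃ x, M < ‖D.u t x‖ := by
  obtain ⟨B, hB⟩ := D.bounded t₀ ht₀
  obtain ⟨t, ht, x, hx⟩ := D.exists_norm_gt_of_F2 hF hν (max M B)
  rcases le_or_gt t t₀ with htt₀ | htt₀
  · exact absurd ((le_max_right M B).trans_lt hx) (not_lt.2 (hB t ⟨ht.1, htt₀⟩ x))
  · exact ⟨t, ⟨htt₀, ht.2⟩, x, (le_max_left M B).trans_lt hx⟩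

end DesignedBlowup

end Summit.NavierStokesRegularity.FluidComputer

end
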